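import Summits.Ventures.LatticeQCDFlow.Scoring.SU2TorusPolyakovLoops
import Summits.Ventures.LatticeQCDFlow.Scoring.SU2TorusWilsonLoopsFiniteVolume
import Summits.Ventures.LatticeQCDFlow.Scoring.SU2TorusPlaquetteEnclosures
import HarnessLib

/-!
# SU(2) on the 2-torus: the Polyakov-loop correlator is `¼(r^{LT} + r^{L(L−T)})` up to an exponentially small remainder, `r = I₂(2β)/I₁(2β)` — the Polyakov-loop string tension equals the Wilson-loop string tension

HONEST FRAMING: exact (Metropolis-corrected) sampling algorithms for lattice gauge theory;
figures of merit are autocorrelation/cost numbers at stated couplings and volumes; no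
continuum-physics claim.

Venture `LatticeQCDFlow` (cell pub-lqcd), sub-topic `Scoring`; FANOUT row 5 (`s0-sun-a`), GEN-12.
NEW WORK of the cell (placement rule); the Polyakov-loop analogue of GEN-11's
`SU2TorusWilsonLoopsFiniteVolume` (the exact area law of the contractible loops).  GEN-11's
`wilson_mean_su2a0_polyakov_pair_two` gives, for `1 ≤ T ≤ L − 1`,
`⟨½ tr P_j · ½ tr P_{j+T}⟩_{(ℤ/L)²,β} = ¼ Σ_n [λ_n^{LT} λ_{n+1}^{L²−LT} + λ_{n+1}^{LT} λ_n^{L²−LT}] / Σ_n λ_n^{L²}`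
(`λ_n = e^{−2β}(I_n(2β) − I_{n+2}(2β))/(n+1) = e^{−2β} I_{n+1}(2β)/β`).  Here:

* `abs_div_tsum_sub_quarter_add_le` — the abstract two-cylinder estimate: for an antitone positive
  summable `w` and `A = a+1`, `B = b+1`, with `Z = Σ_n w_n^{A+B}`,
  `N = ¼ Σ_n [w_n^A w_{n+1}^B + w_{n+1}^A w_n^B]` and `r = w_1/w_0`:
  `|N/Z − ¼(r^A + r^B)| ≤ ½ r^{A+B−1} (Σ_n w_{n+1})/w_0` (the `n = 0` term of `N` IS `¼(r^A + r^B) w_0^{A+B}`;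
  every other term is `O(w_1^{A+B−1} w_n)`);
* **`abs_wilson_mean_su2a0_polyakov_pair_two_sub_le`** — for `β > 0`, `L ≥ 2`, `1 ≤ T ≤ L − 1`:
  `|⟨½ tr P_j · ½ tr P_{j+T}⟩_{(ℤ/L)²,β} − ¼((I₂(2β)/I₁(2β))^{LT} + (I₂(2β)/I₁(2β))^{L²−LT})|`
  `≤ ½ (I₂(2β)/I₁(2β))^{L²−1} · Σ_n I_{n+2}(2β)/I₁(2β)`: the two-point function of Polyakov loops at
  separation `T` is the sum of the two cylinder amplitudes `¼ r^{area}` (areas `LT` and `L(L−T)`, the two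
  ways round the torus), `r = I₂(2β)/I₁(2β)` the same number whose `RT`-th power is the Wilson loop
  `W_{R×T}` — up to a correction smaller than `r^{L²−1}`; and the ELEMENTARY form
  `abs_wilson_mean_su2a0_polyakov_pair_two_sub_le_explicit`: `≤ ½(e^β − 1)(β/2)^{L²−1}`;
* **`tendsto_wilson_mean_su2a0_polyakov_pair_div_two`** — for `β > 0` and fixed `T ≥ 1`, on the tori
  `(ℤ/(L+2T+1))²`, `⟨½ tr P_0 · ½ tr P_T⟩ / (¼ (I₂(2β)/I₁(2β))^{(L+2T+1)T}) → 1` as `L → ∞`: the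
  correlator of two Polyakov loops of length `L' = L+2T+1` decays as `¼ e^{−σ L' T}` with
  `σ = −log(I₂(2β)/I₁(2β))` — the Polyakov-loop string tension of two-dimensional SU(2) lattice
  Yang–Mills equals its Wilson-loop string tension (`SU2TorusWilsonLoopsFiniteVolume`), exactly, at every
  coupling.

Dictionary to the cell's tables (X02 / reference_table v0.3 `polyakov_2pt`, `⟨l(x₀) l(x₀+R)*⟩`):
`β_table = 2β`; e.g. `b = 2.2`, `16²`, `R = 1`: `¼ r^{16} = 1.17326934…·10⁻⁶` (X02 `1.17327e-06`; the
`r^{240}` and remainder terms are below `10⁻⁸⁰`).  Elementary given GEN-11; nothing is cited; no `def`.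
-/

noncomputable section

open Real MeasureTheory Set Function Finset Filter Topology Polynomial.Chebyshev
open Literature.MathematicalPhysics.QuantumFieldTheory Literature.MathematicalPhysics.QuantumLattice
open Literature.Analysis.FunctionSpaces
open Summit.Ventures.LatticeQCDFlow.Exactness
open Summit.Ventures.LatticeQCDFlow.Theory2.Lattice

namespace Summit.Ventures.LatticeQCDFlow.Scoring

/-! ## §1. The abstract two-cylinder estimate -/

section Abstract

variable {w : ℕ → ℝ} (hanti : Antitone w) (hpos : ∀ n, 0 < w n) (hsum : Summable w)
include hanti hpos hsum

/-- The two-cylinder numerator terms `¼ [w_n^{a+1} w_{n+1}^{b+1} + w_{n+1}^{a+1} w_n^{b+1}]` are summable. -/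
theorem summable_polyakovNumTerm (a b : ℕ) :
    Summable fun n : ℕ => (1 / 4 : ℝ) * (w n ^ (a + 1) * w (n + 1) ^ (b + 1) +
      w (n + 1) ^ (a + 1) * w n ^ (b + 1)) := by
  have hb : ∀ n : ℕ, (1 / 4 : ℝ) * (w n ^ (a + 1) * w (n + 1) ^ (b + 1) +
      w (n + 1) ^ (a + 1) * w n ^ (b + 1)) ≤
      (1 / 4 : ℝ) * (w 0 ^ (a + b + 1) * w n + w 0 ^ (a + b + 1) * w n) := by
    intro n
    have hwn := hpos n
    have hwn1 := hpos (n + 1)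
    have hw0 := hpos 0
    have hpa : w n ^ a ≤ w 0 ^ a := pow_le_pow_left₀ hwn.le (hanti (Nat.zero_le _)) _
    have hpb : w (n + 1) ^ (b + 1) ≤ w 0 ^ (b + 1) := pow_le_pow_left₀ hwn1.le (hanti (Nat.zero_le _)) _
    have hpa' : w (n + 1) ^ (a + 1) ≤ w 0 ^ (a + 1) := pow_le_pow_left₀ hwn1.le (hanti (Nat.zero_le _)) _
    have hpb' : w n ^ b ≤ w 0 ^ b := pow_le_pow_left₀ hwn.le (hanti (Nat.zero_le _)) _
    have hA : w n ^ (a + 1) * w (n + 1) ^ (b + 1) ≤ w 0 ^ (a + b + 1) * w n := by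
      calc w n ^ (a + 1) * w (n + 1) ^ (b + 1) = w n * (w n ^ a * w (n + 1) ^ (b + 1)) := by ring
        _ ≤ w n * (w 0 ^ a * w 0 ^ (b + 1)) :=
            mul_le_mul_of_nonneg_left (mul_le_mul hpa hpb (by positivity) (by positivity)) hwn.le
        _ = w 0 ^ (a + b + 1) * w n := by ring
    have hB : w (n + 1) ^ (a + 1) * w n ^ (b + 1) ≤ w 0 ^ (a + b + 1) * w n := by
      calc w (n + 1) ^ (a + 1) * w n ^ (b + 1) = w n * (w (n + 1) ^ (a + 1) * w n ^ b) := by ring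
        _ ≤ w n * (w 0 ^ (a + 1) * w 0 ^ b) :=
            mul_le_mul_of_nonneg_left (mul_le_mul hpa' hpb' (by positivity) (by positivity)) hwn.le
        _ = w 0 ^ (a + b + 1) * w n := by ring
    linarith
  refine Summable.of_nonneg_of_le (fun n => ?_) hb ?_
  · have := (hpos n).le; have := (hpos (n + 1)).le; positivity
  · exact ((hsum.mul_left _).add (hsum.mul_left _)).mul_left _

/-- **The abstract two-cylinder estimate.**  For an antitone, positive, summable `w : ℕ → ℝ` and
`A = a+1`, `B = b+1`: with `Z = Σ_n w_n^{A+B}`, `N = ¼ Σ_n [w_n^A w_{n+1}^B + w_{n+1}^A w_n^B]` and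
`r = w_1/w_0`, `|N/Z − ¼(r^A + r^B)| ≤ ½ r^{A+B−1} · (Σ_n w_{n+1})/w_0`.  (The `n = 0` term of `N` equals
`¼(r^A + r^B)·w_0^{A+B}` exactly; each further term of `N − ¼(r^A + r^B)Z` has modulus at most
`½ w_1^{A+B−1} w_n`.) -/
theorem abs_div_tsum_sub_quarter_add_le (a b : ℕ) :
    |(∑' n : ℕ, (1 / 4 : ℝ) * (w n ^ (a + 1) * w (n + 1) ^ (b + 1) + w (n + 1) ^ (a + 1) * w n ^ (b + 1))) /
        (∑' n : ℕ, w n ^ (a + b + 2)) - 1 / 4 * ((w 1 / w 0) ^ (a + 1) + (w 1 / w 0) ^ (b + 1))| ≤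
      1 / 2 * (w 1 / w 0) ^ (a + b + 1) * ((∑' n : ℕ, w (n + 1)) / w 0) := by
  set N : ℝ := ∑' n : ℕ, (1 / 4 : ℝ) * (w n ^ (a + 1) * w (n + 1) ^ (b + 1) +
    w (n + 1) ^ (a + 1) * w n ^ (b + 1)) with hN
  set Z : ℝ := ∑' n : ℕ, w n ^ (a + b + 2) with hZ
  set S : ℝ := ∑' n : ℕ, w (n + 1) with hS
  set r : ℝ := w 1 / w 0 with hr
  have hw0 := hpos 0
  have hw1 := hpos 1
  have hS0 : 0 ≤ S := tsum_nonneg fun n => (hpos _).le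
  have hr0 : 0 ≤ r := by positivity
  have hr1 : r ≤ 1 := (div_le_one hw0).mpr (hanti (by norm_num))
  have hsumZ : Summable fun n => w n ^ (a + b + 2) := summable_pow_of_antitone hanti hpos hsum _ (by omega)
  have hsumN := summable_polyakovNumTerm hanti hpos hsum a b
  have hsumS : Summable fun n => w (n + 1) := (summable_nat_add_iff 1).mpr hsum
  have hZge : w 0 ^ (a + b + 2) ≤ Z := hsumZ.le_tsum 0 (fun j _ => pow_nonneg (hpos j).le _)
  have hZpos : 0 < Z := lt_of_lt_of_le (pow_pos hw0 _) hZge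
  -- the difference as one series
  set c : ℝ := 1 / 4 * (r ^ (a + 1) + r ^ (b + 1)) with hc
  have hc0 : 0 ≤ c := by positivity
  have hc2 : c ≤ 1 / 2 := by
    have h1 : r ^ (a + 1) ≤ 1 := pow_le_one₀ hr0 hr1
    have h2 : r ^ (b + 1) ≤ 1 := pow_le_one₀ hr0 hr1
    rw [hc]; linarith
  set D : ℕ → ℝ := fun n => (1 / 4 : ℝ) * (w n ^ (a + 1) * w (n + 1) ^ (b + 1) +
    w (n + 1) ^ (a + 1) * w n ^ (b + 1)) - c * w n ^ (a + b + 2) with hD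
  have hsumD : Summable D := hsumN.sub (hsumZ.mul_left _)
  have hdiff : N - c * Z = ∑' n, D n := by
    rw [hN, hZ, ← tsum_mul_left, ← hsumN.tsum_sub (hsumZ.mul_left _)]
  have hD0 : D 0 = 0 := by
    rw [hD, hc, hr]
    simp only
    rw [div_pow, div_pow]
    have hw00 : w 0 ≠ 0 := hw0.ne'
    have hw0a : w 0 ^ (a + 1) ≠ 0 := by positivity
    have hw0b : w 0 ^ (b + 1) ≠ 0 := by positivity
    field_simp
    ring
  have hDtail : ∀ n, |D (n + 1)| ≤ 1 / 2 * (w 1 ^ (a + b + 1) * w (n + 1)) := by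
    intro n
    have hwn1 := hpos (n + 1)
    have hwn2 := hpos (n + 1 + 1)
    -- the two products are at most `w_1^{a+b+1} w_{n+1}`
    have hP1 : w (n + 1) ^ (a + 1) * w (n + 1 + 1) ^ (b + 1) ≤ w 1 ^ (a + b + 1) * w (n + 1) :=
      pow_mul_pow_le_of_antitone hanti hpos (by omega) (by omega) a b
    have hP2 : w (n + 1 + 1) ^ (a + 1) * w (n + 1) ^ (b + 1) ≤ w 1 ^ (a + b + 1) * w (n + 1) := by
      have hm : w (n + 1 + 1) ^ (a + 1) ≤ w (n + 1) ^ (a + 1) :=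
        pow_le_pow_left₀ hwn2.le (hanti (by omega)) _
      calc w (n + 1 + 1) ^ (a + 1) * w (n + 1) ^ (b + 1)
          ≤ w (n + 1) ^ (a + 1) * w (n + 1) ^ (b + 1) := mul_le_mul_of_nonneg_right hm (by positivity)
        _ = w (n + 1) ^ (b + 1) * w (n + 1) ^ (a + 1) := mul_comm _ _
        _ ≤ w 1 ^ (b + a + 1) * w (n + 1) :=
            pow_mul_pow_le_of_antitone hanti hpos (by omega) (by omega) b a
        _ = w 1 ^ (a + b + 1) * w (n + 1) := by rw [Nat.add_comm b a]
    -- the subtracted term is at most `½ w_1^{a+b+1} w_{n+1}`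
    have hP3 : c * w (n + 1) ^ (a + b + 2) ≤ 1 / 2 * (w 1 ^ (a + b + 1) * w (n + 1)) := by
      have hq : w (n + 1) ^ (a + b + 1) ≤ w 1 ^ (a + b + 1) :=
        pow_le_pow_left₀ hwn1.le (hanti (by omega)) _
      have hq' : w (n + 1) ^ (a + b + 2) ≤ w 1 ^ (a + b + 1) * w (n + 1) := by
        rw [pow_succ]
        exact mul_le_mul_of_nonneg_right hq hwn1.le
      calc c * w (n + 1) ^ (a + b + 2) ≤ 1 / 2 * w (n + 1) ^ (a + b + 2) :=
            mul_le_mul_of_nonneg_right hc2 (by positivity)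
        _ ≤ 1 / 2 * (w 1 ^ (a + b + 1) * w (n + 1)) := mul_le_mul_of_nonneg_left hq' (by norm_num)
    have hA : 0 ≤ w (n + 1) ^ (a + 1) * w (n + 1 + 1) ^ (b + 1) := by positivity
    have hB : 0 ≤ w (n + 1 + 1) ^ (a + 1) * w (n + 1) ^ (b + 1) := by positivity
    have hC : 0 ≤ c * w (n + 1) ^ (a + b + 2) := by positivity
    rw [hD]
    simp only
    rw [abs_le]
    constructor <;> nlinarith
  -- `|N − c Z| ≤ ½ w_1^{a+b+1} S`: the head term vanishes, the tail is summed
  have hsumDtail : Summable fun n => D (n + 1) := (summable_nat_add_iff 1).mpr hsumD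
  have habs : |N - c * Z| ≤ 1 / 2 * (w 1 ^ (a + b + 1) * S) := by
    rw [hdiff, hsumD.tsum_eq_zero_add, hD0, zero_add]
    have htail : |∑' n, D (n + 1)| ≤ ∑' n, 1 / 2 * (w 1 ^ (a + b + 1) * w (n + 1)) := by
      have h1 : ‖∑' n, D (n + 1)‖ ≤ ∑' n, ‖D (n + 1)‖ := norm_tsum_le_tsum_norm hsumDtail.norm
      simp only [Real.norm_eq_abs] at h1
      exact h1.trans (hsumDtail.abs.tsum_le_tsum hDtail ((hsumS.mul_left _).mul_left _))
    rw [tsum_mul_left, tsum_mul_left, ← hS] at htail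
    exact htail
  -- divide by `Z ≥ w_0^{a+b+2}`
  have hZ0 : Z ≠ 0 := hZpos.ne'
  have hw00 : w 0 ≠ 0 := hw0.ne'
  have hkey : N / Z - c = (N - c * Z) / Z := by field_simp
  rw [hkey, abs_div, abs_of_pos hZpos, div_le_iff₀ hZpos]
  have hK : 0 ≤ 1 / 2 * r ^ (a + b + 1) * (S / w 0) := by positivity
  have hw1e : w 1 ^ (a + b + 1) = r ^ (a + b + 1) * w 0 ^ (a + b + 1) := by
    rw [hr, div_pow, div_mul_cancel₀]
    positivity
  calc |N - c * Z| ≤ 1 / 2 * (w 1 ^ (a + b + 1) * S) := habs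
    _ = 1 / 2 * r ^ (a + b + 1) * (S / w 0) * w 0 ^ (a + b + 2) := by
        rw [hw1e, pow_succ (w 0) (a + b + 1)]
        field_simp
    _ ≤ 1 / 2 * r ^ (a + b + 1) * (S / w 0) * Z := mul_le_mul_of_nonneg_left hZge hK

end Abstract

/-! ## §2. The SU(2) torus Polyakov-loop correlator: two cylinder amplitudes plus an exponentially small remainder -/

/-- **THE POLYAKOV-LOOP CORRELATOR OF 2-d SU(2) ON THE TORUS IS `¼(r^{LT} + r^{L²−LT})` UP TO `½ r^{L²−1}·Σ_n I_{n+2}/I₁`,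
`r = I₂(2β)/I₁(2β)`.**  For `β > 0`, `L ≥ 2`, a base point `(i, j)` and a separation `1 ≤ T ≤ L − 1`:
`|⟨½ tr P_j · ½ tr P_{j+T}⟩_{(ℤ/L)²,β} − ¼((I₂(2β)/I₁(2β))^{LT} + (I₂(2β)/I₁(2β))^{L²−LT})|`
`≤ ½ (I₂(2β)/I₁(2β))^{L²−1} · (Σ_n I_{n+2}(2β))/I₁(2β)`. -/
theorem abs_wilson_mean_su2a0_polyakov_pair_two_sub_le {L : ℕ} [NeZero L] {β : ℝ} (hβ : 0 < β)
    (i j : ZMod L) {T : ℕ} (hT : 1 ≤ T) (hTL : T + 1 ≤ L) :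
    |∫ V, su2a0 (((List.range L).map fun a : ℕ => V (![i + a, j], 0)).prod) *
          su2a0 (((List.range L).map fun a : ℕ => V (![i + a, j + T], 0)).prod)
        ∂(wilsonMeasure (d := 2) (L := L) (fundamentalRep (Fin 2)) β) -
        1 / 4 * ((besselI 2 (2 * β) / besselI 1 (2 * β)) ^ (L * T) +
          (besselI 2 (2 * β) / besselI 1 (2 * β)) ^ (L ^ 2 - L * T))| ≤
      1 / 2 * (besselI 2 (2 * β) / besselI 1 (2 * β)) ^ (L ^ 2 - 1) *
        ((∑' n : ℕ, besselI (n + 2) (2 * β)) / besselI 1 (2 * β)) := by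
  set w : ℕ → ℝ := fun n => Real.exp (-(2 * β)) * (besselI n (2 * β) - besselI (n + 2) (2 * β)) /
    ((n : ℝ) + 1) with hw
  have hanti : Antitone w := charCoeff_div_succ_antitone hβ
  have hpos : ∀ n, 0 < w n := charCoeff_div_succ_pos hβ
  have hsum : Summable w := summable_charCoeff_div_succ hβ.le
  -- exponents: `LT = a + 1`, `L² − LT = b + 1`
  have hL : 2 ≤ L := by omega
  have hLT : 1 ≤ L * T := Nat.mul_pos (by omega) hT
  have hLTL : L * T + 1 ≤ L ^ 2 := by
    have : L * T + L ≤ L * L := by nlinarith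
    rw [sq]; omega
  obtain ⟨a, ha⟩ : ∃ a, L * T = a + 1 := ⟨L * T - 1, by omega⟩
  obtain ⟨b, hb⟩ : ∃ b, L ^ 2 - L * T = b + 1 := ⟨L ^ 2 - L * T - 1, by omega⟩
  have hV : L ^ 2 = a + b + 2 := by omega
  have hV1 : L ^ 2 - 1 = a + b + 1 := by omega
  have habs := abs_div_tsum_sub_quarter_add_le hanti hpos hsum a b
  -- identify the series
  have hw' : ∀ n, w n = Real.exp (-(2 * β)) * besselI (n + 1) (2 * β) / β := fun n =>
    charCoeff_div_succ_eq_besselI n hβ.ne'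
  have hI1 : 0 < besselI 1 (2 * β) := besselI_pos 1 (by linarith)
  have he : 0 < Real.exp (-(2 * β)) := Real.exp_pos _
  have hratio : w 1 / w 0 = besselI 2 (2 * β) / besselI 1 (2 * β) := by
    rw [hw' 1, hw' 0]
    field_simp
  have hS : (∑' n : ℕ, w (n + 1)) / w 0 = (∑' n : ℕ, besselI (n + 2) (2 * β)) / besselI 1 (2 * β) := by
    have h1 : (fun n : ℕ => w (n + 1)) = fun n => (Real.exp (-(2 * β)) / β) * besselI (n + 2) (2 * β) := by
      funext n; rw [hw' (n + 1)]; ring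
    rw [h1, tsum_mul_left, hw' 0]
    field_simp
  have hw1 : ∀ n : ℕ, Real.exp (-(2 * β)) * (besselI (n + 1) (2 * β) - besselI (n + 1 + 2) (2 * β)) /
      ((n : ℝ) + 2) = w (n + 1) := by
    intro n
    rw [hw]
    push_cast
    ring_nf
  have hnum : ∀ n : ℕ, (1 / 4 : ℝ) *
      ((Real.exp (-(2 * β)) * (besselI n (2 * β) - besselI (n + 2) (2 * β)) / ((n : ℝ) + 1)) ^ (L * T) *
          (Real.exp (-(2 * β)) * (besselI (n + 1) (2 * β) - besselI (n + 1 + 2) (2 * β)) / ((n : ℝ) + 2)) ^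
            (L ^ 2 - L * T) +
        (Real.exp (-(2 * β)) * (besselI (n + 1) (2 * β) - besselI (n + 1 + 2) (2 * β)) / ((n : ℝ) + 2)) ^
            (L * T) *
          (Real.exp (-(2 * β)) * (besselI n (2 * β) - besselI (n + 2) (2 * β)) / ((n : ℝ) + 1)) ^
            (L ^ 2 - L * T)) =
      (1 / 4 : ℝ) * (w n ^ (a + 1) * w (n + 1) ^ (b + 1) + w (n + 1) ^ (a + 1) * w n ^ (b + 1)) := by
    intro n
    rw [hw1 n, hb, ha]
  have hden : ∀ n : ℕ, (Real.exp (-(2 * β)) * (besselI n (2 * β) - besselI (n + 2) (2 * β)) /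
      ((n : ℝ) + 1)) ^ (L ^ 2) = w n ^ (a + b + 2) := fun n => by rw [hV]
  rw [wilson_mean_su2a0_polyakov_pair_two hβ.le i j hT hTL, tsum_congr hnum, tsum_congr hden,
    ← hratio, ← hS, hV1, hb, ha]
  exact habs

/-- **ELEMENTARY EXPLICIT FORM**: for `β > 0`, `L ≥ 2`, `1 ≤ T ≤ L − 1`,
`|⟨½ tr P_j · ½ tr P_{j+T}⟩_{(ℤ/L)²,β} − ¼((I₂/I₁)^{LT} + (I₂/I₁)^{L²−LT})| ≤ ½ (e^β − 1)·(β/2)^{L²−1}`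
(`I₂(2β)/I₁(2β) ≤ β/2`, `Σ_n I_{n+2}(2β) ≤ (e^β − 1) I₁(2β)`). -/
theorem abs_wilson_mean_su2a0_polyakov_pair_two_sub_le_explicit {L : ℕ} [NeZero L] {β : ℝ} (hβ : 0 < β)
    (i j : ZMod L) {T : ℕ} (hT : 1 ≤ T) (hTL : T + 1 ≤ L) :
    |∫ V, su2a0 (((List.range L).map fun a : ℕ => V (![i + a, j], 0)).prod) *
          su2a0 (((List.range L).map fun a : ℕ => V (![i + a, j + T], 0)).prod)
        ∂(wilsonMeasure (d := 2) (L := L) (fundamentalRep (Fin 2)) β) -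
        1 / 4 * ((besselI 2 (2 * β) / besselI 1 (2 * β)) ^ (L * T) +
          (besselI 2 (2 * β) / besselI 1 (2 * β)) ^ (L ^ 2 - L * T))| ≤
      1 / 2 * (Real.exp β - 1) * (β / 2) ^ (L ^ 2 - 1) := by
  have h := abs_wilson_mean_su2a0_polyakov_pair_two_sub_le hβ i j hT hTL
  have hx : (0 : ℝ) ≤ 2 * β := by linarith
  have hI1 : 0 < besselI 1 (2 * β) := besselI_pos 1 (by linarith)
  have hr : besselI 2 (2 * β) / besselI 1 (2 * β) ≤ β / 2 := by
    rw [div_le_iff₀ hI1]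
    have := besselI_succ_le_div_mul 1 hx
    calc besselI 2 (2 * β) ≤ 2 * β / (2 * ((1 : ℕ) + 1)) * besselI 1 (2 * β) := this
      _ = β / 2 * besselI 1 (2 * β) := by push_cast; ring
  have hr0 : 0 ≤ besselI 2 (2 * β) / besselI 1 (2 * β) := div_nonneg (besselI_nonneg 2 hx) hI1.le
  obtain ⟨_, hS⟩ := tsum_besselI_add_two_le hx
  have hS' : (∑' n : ℕ, besselI (n + 2) (2 * β)) / besselI 1 (2 * β) ≤ Real.exp β - 1 := by
    rw [div_le_iff₀ hI1]
    have h2 : 2 * β / 2 = β := by ring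
    rw [h2] at hS
    exact hS
  have hS0 : 0 ≤ (∑' n : ℕ, besselI (n + 2) (2 * β)) / besselI 1 (2 * β) :=
    div_nonneg (tsum_nonneg fun n => besselI_nonneg _ hx) hI1.le
  calc _ ≤ _ := h
    _ ≤ 1 / 2 * (β / 2) ^ (L ^ 2 - 1) * (Real.exp β - 1) := by
        have h1 : (besselI 2 (2 * β) / besselI 1 (2 * β)) ^ (L ^ 2 - 1) ≤ (β / 2) ^ (L ^ 2 - 1) :=
          pow_le_pow_left₀ hr0 hr _
        have h2 : 1 / 2 * (besselI 2 (2 * β) / besselI 1 (2 * β)) ^ (L ^ 2 - 1) ≤ 1 / 2 * (β / 2) ^ (L ^ 2 - 1) :=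
          mul_le_mul_of_nonneg_left h1 (by norm_num)
        exact mul_le_mul h2 hS' hS0 (by positivity)
    _ = _ := by ring

/-! ## §3. The thermodynamic limit: `⟨½ tr P_0 · ½ tr P_T⟩ ∼ ¼ e^{−σ L T}` with the Wilson-loop string tension `σ = −log(I₂(2β)/I₁(2β))` -/

/-- `0 < I₂(2β)/I₁(2β)` for `β > 0`. -/
theorem besselI_two_div_one_pos {β : ℝ} (hβ : 0 < β) : 0 < besselI 2 (2 * β) / besselI 1 (2 * β) :=
  div_pos (besselI_pos 2 (by linarith)) (besselI_pos 1 (by linarith))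

/-- **THE POLYAKOV-LOOP STRING TENSION EQUALS THE WILSON-LOOP STRING TENSION.**  For `β > 0` and a fixed
separation `T ≥ 1`, on the tori `(ℤ/(L+2T+1))²` (side `L' = L+2T+1 > 2T`), as `L → ∞`:
`⟨½ tr P_0 · ½ tr P_T⟩_{(ℤ/L')²,β} / (¼ (I₂(2β)/I₁(2β))^{L'T}) → 1` — the correlator of two Polyakov
loops of length `L'` at distance `T` is `¼ e^{−σ L' T}(1 + o(1))` with `σ = −log(I₂(2β)/I₁(2β))`, the
string tension of the Wilson-loop area law `⟨½ tr W_{R×T}⟩ → (I₂(2β)/I₁(2β))^{RT}`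
(`SU2TorusWilsonLoopsFiniteVolume.tendsto_wilson_mean_su2a0_loop_two`). -/
theorem tendsto_wilson_mean_su2a0_polyakov_pair_div_two {β : ℝ} (hβ : 0 < β) {T : ℕ} (hT : 1 ≤ T) :
    Tendsto (fun L : ℕ =>
        (∫ V, su2a0 (((List.range (L + 2 * T + 1)).map fun a : ℕ =>
              V (![(0 : ZMod (L + 2 * T + 1)) + a, 0], 0)).prod) *
            su2a0 (((List.range (L + 2 * T + 1)).map fun a : ℕ =>
              V (![(0 : ZMod (L + 2 * T + 1)) + a, 0 + T], 0)).prod)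
          ∂(wilsonMeasure (d := 2) (L := L + 2 * T + 1) (fundamentalRep (Fin 2)) β)) /
          (1 / 4 * (besselI 2 (2 * β) / besselI 1 (2 * β)) ^ ((L + 2 * T + 1) * T)))
      atTop (𝓝 1) := by
  obtain ⟨hr0, hr1⟩ := besselI_two_div_one_lt_one hβ
  have hrpos := besselI_two_div_one_pos hβ
  set r : ℝ := besselI 2 (2 * β) / besselI 1 (2 * β) with hr
  set S : ℝ := (∑' n : ℕ, besselI (n + 2) (2 * β)) / besselI 1 (2 * β) with hS
  have hS0 : 0 ≤ S := div_nonneg (tsum_nonneg fun n => besselI_nonneg _ (by linarith))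
    (besselI_pos 1 (by linarith)).le
  -- the two error exponents `m₁ = L'² − 2L'T`, `m₂ = L'² − 1 − L'T` tend to infinity
  have hm1 : Tendsto (fun L : ℕ => (L + 2 * T + 1) ^ 2 - 2 * ((L + 2 * T + 1) * T)) atTop atTop := by
    refine tendsto_atTop_mono (fun L => ?_) tendsto_id
    have h2 : L + 2 * ((L + 2 * T + 1) * T) ≤ (L + 2 * T + 1) * (L + 2 * T + 1) := by nlinarith
    simpa [sq] using Nat.le_sub_of_add_le h2
  have hm2 : Tendsto (fun L : ℕ => (L + 2 * T + 1) ^ 2 - 1 - (L + 2 * T + 1) * T) atTop atTop := by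
    refine tendsto_atTop_mono (fun L => ?_) tendsto_id
    have h2 : L + 1 + (L + 2 * T + 1) * T ≤ (L + 2 * T + 1) * (L + 2 * T + 1) := by nlinarith
    have : L ≤ (L + 2 * T + 1) * (L + 2 * T + 1) - 1 - (L + 2 * T + 1) * T := by omega
    simpa [sq] using this
  have hpow1 : Tendsto (fun L : ℕ => r ^ ((L + 2 * T + 1) ^ 2 - 2 * ((L + 2 * T + 1) * T))) atTop (𝓝 0) :=
    (tendsto_pow_atTop_nhds_zero_of_lt_one hr0 hr1).comp hm1
  have hpow2 : Tendsto (fun L : ℕ => r ^ ((L + 2 * T + 1) ^ 2 - 1 - (L + 2 * T + 1) * T)) atTop (𝓝 0) :=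
    (tendsto_pow_atTop_nhds_zero_of_lt_one hr0 hr1).comp hm2
  have hbound : Tendsto (fun L : ℕ => r ^ ((L + 2 * T + 1) ^ 2 - 2 * ((L + 2 * T + 1) * T)) +
      2 * S * r ^ ((L + 2 * T + 1) ^ 2 - 1 - (L + 2 * T + 1) * T)) atTop (𝓝 0) := by
    simpa using hpow1.add (hpow2.const_mul (2 * S))
  rw [tendsto_iff_norm_sub_tendsto_zero]
  refine squeeze_zero (fun L => norm_nonneg _) (fun L => ?_) hbound
  rw [Real.norm_eq_abs]
  -- abbreviations for this `L`
  set L' : ℕ := L + 2 * T + 1 with hL'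
  haveI : NeZero L' := ⟨by omega⟩
  have hTL : T + 1 ≤ L' := by omega
  have h := abs_wilson_mean_su2a0_polyakov_pair_two_sub_le (L := L') hβ 0 0 hT hTL
  set P : ℝ := ∫ V, su2a0 (((List.range L').map fun a : ℕ => V (![(0 : ZMod L') + a, 0], 0)).prod) *
      su2a0 (((List.range L').map fun a : ℕ => V (![(0 : ZMod L') + a, 0 + T], 0)).prod)
    ∂(wilsonMeasure (d := 2) (L := L') (fundamentalRep (Fin 2)) β) with hP
  -- exponent bookkeeping: `L'² − L'T = L'T + m₁`, `L'² − 1 = L'T + m₂`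
  have hA2 : 2 * (L' * T) ≤ L' ^ 2 := by
    have : 2 * (L' * T) ≤ L' * L' := by
      have : 2 * T ≤ L' := by omega
      nlinarith
    simpa [sq] using this
  have hA1 : L' * T + 1 ≤ L' ^ 2 := by
    have h1 : 1 ≤ L' * T := Nat.mul_pos (by omega) hT
    omega
  have he1 : L' ^ 2 - L' * T = L' * T + (L' ^ 2 - 2 * (L' * T)) := by omega
  have he2 : L' ^ 2 - 1 = L' * T + (L' ^ 2 - 1 - L' * T) := by omega
  set m₁ : ℕ := L' ^ 2 - 2 * (L' * T) with hm₁
  set m₂ : ℕ := L' ^ 2 - 1 - L' * T with hm₂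
  rw [he1, he2, pow_add, pow_add] at h
  -- `|P − ¼ r^{A}| ≤ ¼ r^{A} r^{m₁} + ½ r^{A} r^{m₂} S`
  have hrA : 0 < r ^ (L' * T) := pow_pos hrpos _
  have hq : 0 < 1 / 4 * r ^ (L' * T) := by positivity
  have hkey : P / (1 / 4 * r ^ (L' * T)) - 1 = (P - 1 / 4 * r ^ (L' * T)) / (1 / 4 * r ^ (L' * T)) := by
    field_simp
  rw [hkey, abs_div, abs_of_pos hq, div_le_iff₀ hq]
  have h1 : |P - 1 / 4 * r ^ (L' * T)| ≤
      1 / 4 * (r ^ (L' * T) * r ^ m₁) + 1 / 2 * (r ^ (L' * T) * r ^ m₂) * S := by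
    have hnn : 0 ≤ 1 / 4 * (r ^ (L' * T) * r ^ m₁) := by positivity
    rw [abs_le] at h ⊢
    constructor <;> nlinarith [h.1, h.2]
  calc |P - 1 / 4 * r ^ (L' * T)| ≤ 1 / 4 * (r ^ (L' * T) * r ^ m₁) + 1 / 2 * (r ^ (L' * T) * r ^ m₂) * S := h1
    _ = (r ^ m₁ + 2 * S * r ^ m₂) * (1 / 4 * r ^ (L' * T)) := by ring

end Summit.Ventures.LatticeQCDFlow.Scoring
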